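import Summits.QuantumAdvantage.QuantumAdvantage.Theorems.CubicForrelationNearExactIsExactKtGapTwoClosure

/-!
# Crux `CubicForrelation.NearExactIsExact` (stmt-QuantumAdvantage-14043) — the SECOND Kasami–Tokura gap of cubics, III: the inductive step
  (from the gap `(3.5·2^k, 3.75·2^k)` on `k + 4` bits to a linear Diophantine system on `k + 5` bits, with the closure constraint
  `C + 1 = 2^j` from `…KtGapTwoClosure.lean`)

Certificate seat `b2b-cforr-cert` (gen 18).  HONEST FRAMING: a coding-theory BRICK (standard axioms), uniform in `k`; the closing arithmetic and
the statements for `m ≤ 12` bits and the type-O consequence at `n = 12` are in `…KtGapTwoCubic.lean`.  NOT summit progress.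

`ktg2_step`.  Let `c` be cubic on `m = k + 5` bits with support `E`, `7L < w = #E < 7.5L` (`L = 2^k`), `t = w − 7L`, and assume that no cubic on
`k + 4` bits has weight in `(3.5L, 3.75L)`.  (i) Every derivative `c ⊕ c(·⊕a)` is a plateaued quadratic with Walsh value `> 2^m/16` at `0`, so
`I(a) = #(E ∩ (E⊕a)) ∈ {t, L + t, 3L + t, w}` (`ktg2_deriv_values`).  (ii) A period `a ≠ 0` (`I(a) = w`) would make `c` descend to `k + 4` bits
with weight `w/2 ∈ (3.5L, 3.75L)`.  (iii) For `z ≠ 0` the two halves `#(E ∩ {⟨x,z⟩ = b})` are weights of cubics on `k + 4` bits (`ktg_restrict`),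
hence in `{0, 2L, 3L, 3.5L} ∪ [3.75L, ∞)` (`rm3_weights_below_seven_quarters` + the hypothesis), they add up to `w`, and `0` is excluded
(`E` lies in no hyperplane, `ktg_no_hyperplane`): so `F(z) = Σ_E (−1)^{x·z} ∈ {±t, ±(L+t), ±(3L+t)}`.  (iv) Parseval, the fourth moment and
`Σ_a I(a) = w²` give the linear system in the multiplicities `A, B, C` (of `|F| = t, L+t, 3L+t`) and `n₁, n₂, n₃` (of `I = 3L+t, L+t, t`), and
`Σ I = w²` also gives `L ∣ t²`.  (v) NEW (closure): if `|F(z)| = 3L + t` then the small half `U = E ∩ {⟨x,z⟩ = b}` has `2L = 2^{m−4}` points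
and is the support of the degree-`≤ 4` function `c·[⟨x,z⟩ = b]` — a minimum-weight word of `RM(4,m)`, hence a FLAT, whose character sums are
`0, ±2L` (`ktg2_minweight_twist_sum`); for another such `z'`, `F(z ⊕ z') = ±(2·Σ_U(−1)^{x·z'} − F(z'))` is `±(3L+t)` or `±(L−t), ±w` — the last
two are impossible (`2t < L`, no hyperplane), so the directions with `|F| = 3L+t` together with `0` are `⊕`-closed: `C + 1 = 2^j`
(`ktg2_xor_closed_card`).

References: T. Kasami, N. Tokura, IEEE Trans. IT 16 (1970) 752–759, Thm 1; MacWilliams–Sloane (1977) Ch. 13 §4, Ch. 15 §3; O'Donnell (2014)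
§3.3.  Axioms: standard.
-/

set_option linter.dupNamespace false -- D-0017: single-problem summit ⇒ `QuantumAdvantage.QuantumAdvantage` by design

noncomputable section

namespace Summit.QuantumAdvantage.QuantumAdvantage.Theorems.CubicForrelation.NearExactIsExact

open Finset
open Literature.Computability.QuantumComplexity
open Literature.Computability.QuantumComplexity.BuzetChailloux (bxor zeroVec bxor_bxor_cancel_left bxor_zeroVec zeroVec_bxor bxor_comm
  bxor_self twist_zeroVec_right twist_bxor_right)
open Literature.Computability.QuantumComplexity.DerivativeWalsh (W twist_bxor_left)
open Literature.Computability.QuantumComplexity.Simon (twist_eq_one_or)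
open Summit.QuantumAdvantage.QuantumAdvantage.Theorems.SignedCubicForrelationNotPrBPP (knf_isDegLeFun_ip)


/-! ### The inductive step -/

/-- **Inductive step for the second gap.**  If no cubic on `k + 4` bits has weight in `(3.5·2^k, 3.75·2^k)`, then a cubic `c` on `k + 5` bits
with `7·2^k < w = #{c = 1} < 7.5·2^k` yields natural numbers `t, A, B, C, n₁, n₂, n₃, j` with `w = 7·2^k + t`, `2^k ∣ t²`,
`A + B + C = n₁ + n₂ + n₃ = 2^{k+5} − 1`, `A t² + B (2^k + t)² + C (3·2^k + t)² + w² = 2^{k+5} w` (Parseval),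
`n₁ (3·2^k + t) + n₂ (2^k + t) + n₃ t + w = w²` (`Σ I = w²`),
`w⁴ + A t⁴ + B (2^k + t)⁴ + C (3·2^k + t)⁴ = 2^{k+5} (w² + n₁ (3·2^k + t)² + n₂ (2^k + t)² + n₃ t²)` (fourth moment),
and the closure constraint `C + 1 = 2^j`. [this work] -/
theorem ktg2_step (k : ℕ)
    (ih : ∀ c' : (Fin (k + 4) → Bool) → Bool, IsDegLeFun 3 c' →
      ¬ (7 * 2 ^ k < 2 * #(univ.filter fun y => c' y = true) ∧ 4 * #(univ.filter fun y => c' y = true) < 15 * 2 ^ k))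
    (c : (Fin (k + 4 + 1) → Bool) → Bool) (hc : IsDegLeFun 3 c)
    (h1 : 7 * 2 ^ k < #(univ.filter fun x => c x = true)) (h2 : 2 * #(univ.filter fun x => c x = true) < 15 * 2 ^ k) :
    ∃ w t A B C n₁ n₂ n₃ j : ℕ, w = #(univ.filter fun x => c x = true) ∧ w = 7 * 2 ^ k + t ∧ 2 ^ k ∣ t * t ∧
      A + B + C + 1 = 32 * 2 ^ k ∧ A * t ^ 2 + B * (2 ^ k + t) ^ 2 + C * (3 * 2 ^ k + t) ^ 2 + w ^ 2 = 32 * 2 ^ k * w ∧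
      n₁ + n₂ + n₃ + 1 = 32 * 2 ^ k ∧ n₁ * (3 * 2 ^ k + t) + n₂ * (2 ^ k + t) + n₃ * t + w = w ^ 2 ∧
      w ^ 4 + A * t ^ 4 + B * (2 ^ k + t) ^ 4 + C * (3 * 2 ^ k + t) ^ 4 =
        32 * 2 ^ k * (w ^ 2 + n₁ * (3 * 2 ^ k + t) ^ 2 + n₂ * (2 ^ k + t) ^ 2 + n₃ * t ^ 2) ∧
      C + 1 = 2 ^ j := by
  classical
  set S := univ.filter (fun x : Fin (k + 4 + 1) → Bool => c x = true) with hSdef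
  have hmemS : ∀ x, x ∈ S ↔ c x = true := fun x => by simp [hSdef]
  have hN : (2 : ℕ) ^ (k + 4 + 1) = 32 * 2 ^ k := by ring
  have hN4 : (2 : ℕ) ^ (k + 4) = 16 * 2 ^ k := by ring
  have hNR : (2 : ℝ) ^ (k + 4 + 1) = 32 * 2 ^ k := by ring
  have hLpos : 0 < 2 ^ k := Nat.two_pow_pos k
  obtain ⟨t, hwt⟩ : ∃ t, #S = 7 * 2 ^ k + t := ⟨#S - 7 * 2 ^ k, by omega⟩
  have ht0 : 0 < t := by omega
  have h2t : 2 * t < 2 ^ k := by omega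
  have h2' : 64 * #S < 15 * 2 ^ (k + 4 + 1) := by rw [hN]; omega
  set L : ℝ := (2 : ℝ) ^ k with hLdef
  have hLR : ((2 ^ k : ℕ) : ℝ) = L := by push_cast; rfl
  have hLposR : (0 : ℝ) < L := by positivity
  have htR : (0 : ℝ) < (t : ℝ) := by exact_mod_cast ht0
  have h2tR : 2 * (t : ℝ) < L := by rw [← hLR]; exact_mod_cast h2t
  have hw : ((#S : ℕ) : ℝ) = 7 * L + t := by rw [hwt]; push_cast; rw [hLdef]
  /- (1) derivative intersections `I(a) ∈ {t, L + t, 3L + t, w}` -/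
  have hIval : ∀ a, #(S.filter fun x => bxor x a ∈ S) = t ∨ #(S.filter fun x => bxor x a ∈ S) = 2 ^ k + t ∨
      #(S.filter fun x => bxor x a ∈ S) = 3 * 2 ^ k + t ∨ #(S.filter fun x => bxor x a ∈ S) = #S := by
    intro a
    have key := ktg2_deriv_values c hc h2' a
    rw [hN] at key
    change 32 * #(S.filter fun x => bxor x a ∈ S) + 7 * (32 * 2 ^ k) = 32 * #S ∨
      16 * #(S.filter fun x => bxor x a ∈ S) + 3 * (32 * 2 ^ k) = 16 * #S ∨
      8 * #(S.filter fun x => bxor x a ∈ S) + 32 * 2 ^ k = 8 * #S ∨ #(S.filter fun x => bxor x a ∈ S) = #S at key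
    omega
  have hIpos : ∀ a, 0 < #(S.filter fun x => bxor x a ∈ S) := fun a => by rcases hIval a with h | h | h | h <;> omega
  /- (2) no periods: a period would let `c` descend to `k + 4` bits with weight `w/2` inside the smaller gap -/
  have hnoper : ∀ a, a ≠ zeroVec → #(S.filter fun x => bxor x a ∈ S) ≠ #S := by
    intro a ha hIa
    have hsub : S.filter (fun x => bxor x a ∈ S) = S := eq_of_subset_of_card_le (filter_subset _ _) (by rw [hIa])
    have hinv : ∀ x, x ∈ S → bxor x a ∈ S := fun x hx => by
      have : x ∈ S.filter (fun x => bxor x a ∈ S) := by rw [hsub]; exact hx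
      exact (mem_filter.1 this).2
    have hinv' : ∀ x, c (bxor x a) = c x := by
      intro x
      by_cases hx : x ∈ S
      · rw [(hmemS _).1 (hinv x hx), (hmemS _).1 hx]
      · have hxa : bxor x a ∉ S := fun h => hx (by simpa [iw_bxor_assoc] using hinv _ h)
        have e1 : c x = false := by simpa [hmemS] using hx
        have e2 : c (bxor x a) = false := by simpa [hmemS] using hxa
        rw [e1, e2]
    obtain ⟨i₀, hi₀⟩ : ∃ i, a i = true := by
      by_contra h
      push Not at h
      exact ha (funext fun i => by simpa [zeroVec] using h i)
    set z : Fin (k + 4 + 1) → Bool := fun i => decide (i = i₀) with hz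
    have hzi : z i₀ = true := by simp [hz]
    have hcoord : ∀ x : Fin (k + 4 + 1) → Bool, decide (Odd #(univ.filter fun i => (x i && z i) = true)) = x i₀ := by
      intro x
      rw [ktg_card_and_split _ _ i₀, hzi, Bool.and_true]
      have h0 : #(univ.filter fun j : Fin (k + 4) => (x (i₀.succAbove j) && z (i₀.succAbove j)) = true) = 0 := by
        refine card_eq_zero.2 (filter_eq_empty_iff.2 fun j _ => ?_)
        simp [hz, Fin.succAbove_ne]
      rw [h0, add_zero]
      cases x i₀ <;> simp
    obtain ⟨c', hc', hcard'⟩ := ktg_restrict (k := k + 4) c hc z i₀ hzi false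
    have hsym : #(univ.filter fun x => c x = true ∧ decide (Odd #(univ.filter fun i => (x i && z i) = true)) = true) =
        #(univ.filter fun x => c x = true ∧ decide (Odd #(univ.filter fun i => (x i && z i) = true)) = false) := by
      simp_rw [hcoord]
      refine card_nbij' (fun x => bxor x a) (fun x => bxor x a) (fun x hx => ?_) (fun x hx => ?_)
        (fun x _ => by simp [iw_bxor_assoc]) (fun x _ => by simp [iw_bxor_assoc])
      · rw [mem_coe, mem_filter] at hx ⊢
        refine ⟨mem_univ _, by rw [hinv']; exact hx.2.1, ?_⟩
        show (x i₀ ^^ a i₀) = false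
        rw [hx.2.2, hi₀]; rfl
      · rw [mem_coe, mem_filter] at hx ⊢
        refine ⟨mem_univ _, by rw [hinv']; exact hx.2.1, ?_⟩
        show (x i₀ ^^ a i₀) = true
        rw [hx.2.2, hi₀]; rfl
    have hadd := ktg_half_add c z
    rw [hsym, ← hcard', ← hSdef] at hadd
    exact ih c' hc' ⟨by omega, by omega⟩
  /- (3) weights of cubics on `k + 4` bits: `0, 2L, 3L, 3.5L` or `≥ 3.75L` -/
  have hQ : ∀ (e : (Fin (k + 4) → Bool) → Bool), IsDegLeFun 3 e →
      #(univ.filter fun y => e y = true) = 0 ∨ #(univ.filter fun y => e y = true) = 2 * 2 ^ k ∨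
        #(univ.filter fun y => e y = true) = 3 * 2 ^ k ∨ 2 * #(univ.filter fun y => e y = true) = 7 * 2 ^ k ∨
        15 * 2 ^ k ≤ 4 * #(univ.filter fun y => e y = true) := by
    intro e he
    by_cases hlt : 32 * #(univ.filter fun y => e y = true) < 7 * 2 ^ (k + 4)
    · have h := rm3_weights_below_seven_quarters e he hlt
      rw [hN4] at h
      omega
    · have h := ih e he
      rw [hN4] at hlt
      omega
  /- (4) half weights along any hyperplane `z ≠ 0` -/
  have hhalf : ∀ z : Fin (k + 4 + 1) → Bool, z ≠ zeroVec →
      #(univ.filter fun x => c x = true ∧ decide (Odd #(univ.filter fun i => (x i && z i) = true)) = true) = 0 ∨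
      #(univ.filter fun x => c x = true ∧ decide (Odd #(univ.filter fun i => (x i && z i) = true)) = true) = 2 * 2 ^ k ∨
      #(univ.filter fun x => c x = true ∧ decide (Odd #(univ.filter fun i => (x i && z i) = true)) = true) = 3 * 2 ^ k ∨
      2 * #(univ.filter fun x => c x = true ∧ decide (Odd #(univ.filter fun i => (x i && z i) = true)) = true) = 7 * 2 ^ k ∨
      #(univ.filter fun x => c x = true ∧ decide (Odd #(univ.filter fun i => (x i && z i) = true)) = true) + 2 * 2 ^ k = #S ∨
      #(univ.filter fun x => c x = true ∧ decide (Odd #(univ.filter fun i => (x i && z i) = true)) = true) + 3 * 2 ^ k = #S ∨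
      2 * #(univ.filter fun x => c x = true ∧ decide (Odd #(univ.filter fun i => (x i && z i) = true)) = true) + 7 * 2 ^ k = 2 * #S ∨
      #(univ.filter fun x => c x = true ∧ decide (Odd #(univ.filter fun i => (x i && z i) = true)) = true) = #S := by
    intro z hz
    obtain ⟨i₀, hi₀⟩ : ∃ i, z i = true := by
      by_contra h
      push Not at h
      exact hz (funext fun i => by simpa [zeroVec] using h i)
    obtain ⟨cT, hcT, hcardT⟩ := ktg_restrict (k := k + 4) c hc z i₀ hi₀ true
    obtain ⟨cF, hcF, hcardF⟩ := ktg_restrict (k := k + 4) c hc z i₀ hi₀ false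
    have hadd := ktg_half_add c z
    rw [← hcardT, ← hcardF, ← hSdef] at hadd
    have hQT := hQ cT hcT
    have hQF := hQ cF hcF
    rw [← hcardT]
    omega
  /- (5) the character sum `F(z)`: `F(0) = w`, and `F(z)² ∈ {t², (L + t)², (3L + t)²}` for `z ≠ 0` -/
  set F : (Fin (k + 4 + 1) → Bool) → ℝ := fun z => ∑ x ∈ S, twist x z with hFdef
  have hF0 : F zeroVec = #S := by
    simp only [F]
    rw [sum_congr rfl fun x _ => twist_zeroVec_right x, sum_const]; norm_num
  have hFz : ∀ z, F z = #S - 2 * (#(univ.filter fun x => c x = true ∧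
      decide (Odd #(univ.filter fun i => (x i && z i) = true)) = true) : ℝ) := fun z => ktg_F_half c z
  -- the six possible values, as a disjunction on `F z` itself
  have hFval : ∀ z, z ≠ zeroVec → F z = t ∨ F z = L + t ∨ F z = 3 * L + t ∨ F z = -t ∨ F z = -(L + t) ∨ F z = -(3 * L + t) := by
    intro z hz
    obtain ⟨hne1, hne2⟩ := ktg_no_hyperplane S hIpos z hz
    change F z ≠ _ at hne1
    change F z ≠ _ at hne2
    have e := hFz z
    rcases hhalf z hz with h | h | h | h | h | h | h | h
    · exfalso; apply hne1; rw [e, h]; norm_num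
    · right; right; left; rw [e, h]; push_cast; rw [hw, hLdef]; ring
    · right; left; rw [e, h]; push_cast; rw [hw, hLdef]; ring
    · left
      have h' : 2 * (#(univ.filter fun x => c x = true ∧ decide (Odd #(univ.filter fun i => (x i && z i) = true)) = true) : ℝ) =
          7 * L := by rw [← hLR]; exact_mod_cast h
      rw [e, h', hw]; ring
    · right; right; right; right; right
      have h' : (#(univ.filter fun x => c x = true ∧ decide (Odd #(univ.filter fun i => (x i && z i) = true)) = true) : ℝ) =
          #S - 2 * L := by rw [← hLR, ← h]; push_cast; ring
      rw [e, h', hw]; ring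
    · right; right; right; right; left
      have h' : (#(univ.filter fun x => c x = true ∧ decide (Odd #(univ.filter fun i => (x i && z i) = true)) = true) : ℝ) =
          #S - 3 * L := by rw [← hLR, ← h]; push_cast; ring
      rw [e, h', hw]; ring
    · right; right; right; left
      have h' : 2 * (#(univ.filter fun x => c x = true ∧ decide (Odd #(univ.filter fun i => (x i && z i) = true)) = true) : ℝ) =
          2 * #S - 7 * L := by rw [← hLR]; have := congrArg (fun n : ℕ => (n : ℝ)) h; push_cast at this; linarith
      rw [e]; linarith [hw]
    · exfalso; apply hne2; rw [e, h]; ring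
  have hFsq : ∀ z, z ≠ zeroVec → F z ^ 2 = (t : ℝ) ^ 2 ∨ F z ^ 2 = (L + t) ^ 2 ∨ F z ^ 2 = (3 * L + t) ^ 2 := by
    intro z hz
    rcases hFval z hz with h | h | h | h | h | h <;> rw [h]
    · exact Or.inl rfl
    · exact Or.inr (Or.inl rfl)
    · exact Or.inr (Or.inr rfl)
    · exact Or.inl (by ring)
    · exact Or.inr (Or.inl (by ring))
    · exact Or.inr (Or.inr (by ring))
  have hαβ : (t : ℝ) ^ 2 ≠ (L + t) ^ 2 := by nlinarith
  have hαγ : (t : ℝ) ^ 2 ≠ (3 * L + t) ^ 2 := by nlinarith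
  have hβγ : (L + t : ℝ) ^ 2 ≠ (3 * L + t) ^ 2 := by nlinarith
  obtain ⟨hPars, hABC⟩ := ktg2_sum_three_values (fun z => F z ^ 2) zeroVec _ _ _ hαβ hαγ hβγ hFsq (fun x => x)
  obtain ⟨hFour, -⟩ := ktg2_sum_three_values (fun z => F z ^ 2) zeroVec _ _ _ hαβ hαγ hβγ hFsq (fun x => x ^ 2)
  set A := #(univ.filter fun z : Fin (k + 4 + 1) → Bool => z ≠ zeroVec ∧ F z ^ 2 = (t : ℝ) ^ 2) with hAdef
  set B := #(univ.filter fun z : Fin (k + 4 + 1) → Bool => z ≠ zeroVec ∧ F z ^ 2 = (L + t) ^ 2) with hBdef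
  set C := #(univ.filter fun z : Fin (k + 4 + 1) → Bool => z ≠ zeroVec ∧ F z ^ 2 = (3 * L + t) ^ 2) with hCdef
  /- (6) the derivative intersections off `0`: `I(a) ∈ {3L + t, L + t, t}` -/
  set I : (Fin (k + 4 + 1) → Bool) → ℝ := fun a => (#(S.filter fun x => bxor x a ∈ S) : ℝ) with hIdef
  have hI0 : I zeroVec = #S := by
    simp only [I]
    rw [filter_true_of_mem fun x hx => by rw [bxor_zeroVec]; exact hx]
  have hIval' : ∀ a, a ≠ zeroVec → I a = 3 * L + t ∨ I a = L + t ∨ I a = t := by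
    intro a ha
    rcases hIval a with h | h | h | h
    · right; right; simp only [I]; rw [h]
    · right; left; simp only [I]; rw [h]; push_cast; rw [hLdef]
    · left; simp only [I]; rw [h]; push_cast; rw [hLdef]
    · exact absurd h (hnoper a ha)
  have hαβ' : (3 * L + t : ℝ) ≠ L + t := by nlinarith
  have hαγ' : (3 * L + t : ℝ) ≠ t := by nlinarith
  have hβγ' : (L + t : ℝ) ≠ t := by nlinarith
  obtain ⟨hIsum, hn⟩ := ktg2_sum_three_values I zeroVec _ _ _ hαβ' hαγ' hβγ' hIval' (fun x => x)
  obtain ⟨hIsq, -⟩ := ktg2_sum_three_values I zeroVec _ _ _ hαβ' hαγ' hβγ' hIval' (fun x => x ^ 2)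
  set n₁ := #(univ.filter fun a : Fin (k + 4 + 1) → Bool => a ≠ zeroVec ∧ I a = 3 * L + t) with hn₁def
  set n₂ := #(univ.filter fun a : Fin (k + 4 + 1) → Bool => a ≠ zeroVec ∧ I a = L + t) with hn₂def
  set n₃ := #(univ.filter fun a : Fin (k + 4 + 1) → Bool => a ≠ zeroVec ∧ I a = t) with hn₃def
  /- (7) the identities -/
  have hcardU : Fintype.card (Fin (k + 4 + 1) → Bool) = 32 * 2 ^ k := by
    rw [Fintype.card_fun, Fintype.card_bool, Fintype.card_fin, hN]
  have hParsEq : ∑ z, F z ^ 2 = (2 : ℝ) ^ (k + 4 + 1) * #S := ktg_parseval S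
  have hFourEq : ∑ z, (F z ^ 2) ^ 2 = (2 : ℝ) ^ (k + 4 + 1) * ∑ a, I a ^ 2 := by
    rw [show (∑ z, (F z ^ 2) ^ 2) = ∑ z, F z ^ 4 from sum_congr rfl fun z _ => by ring]
    exact ktg_fourth S
  have hIsumEq : ∑ a, I a = (#S : ℝ) * #S := by
    have h := ktg_sum_I S
    have h' : ((∑ a, #(S.filter fun x => bxor x a ∈ S) : ℕ) : ℝ) = ((#S * #S : ℕ) : ℝ) := by rw [h]
    push_cast at h'
    exact h'
  rw [hcardU] at hABC hn
  have hP_R : (A : ℝ) * (t : ℝ) ^ 2 + (B : ℝ) * (L + t) ^ 2 + (C : ℝ) * (3 * L + t) ^ 2 + (#S : ℝ) ^ 2 = 32 * L * #S := by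
    have h := hPars
    rw [hParsEq, hF0, hNR] at h
    linear_combination (-1 : ℝ) * h
  have hI_R : (n₁ : ℝ) * (3 * L + t) + (n₂ : ℝ) * (L + t) + (n₃ : ℝ) * t + (#S : ℝ) = (#S : ℝ) ^ 2 := by
    have h := hIsum
    rw [hIsumEq, hI0] at h
    linear_combination (-1 : ℝ) * h
  have h4_R : (#S : ℝ) ^ 4 + (A : ℝ) * (t : ℝ) ^ 4 + (B : ℝ) * (L + t) ^ 4 + (C : ℝ) * (3 * L + t) ^ 4 =
      32 * L * ((#S : ℝ) ^ 2 + (n₁ : ℝ) * (3 * L + t) ^ 2 + (n₂ : ℝ) * (L + t) ^ 2 + (n₃ : ℝ) * (t : ℝ) ^ 2) := by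
    have h4 := hFour
    have hI2 := hIsq
    rw [hFourEq, hF0, hNR] at h4
    rw [hI0] at hI2
    rw [hI2] at h4
    linear_combination (-1 : ℝ) * h4
  have hP_N : A * t ^ 2 + B * (2 ^ k + t) ^ 2 + C * (3 * 2 ^ k + t) ^ 2 + #S ^ 2 = 32 * 2 ^ k * #S := by
    have e : ((A * t ^ 2 + B * (2 ^ k + t) ^ 2 + C * (3 * 2 ^ k + t) ^ 2 + #S ^ 2 : ℕ) : ℝ) = ((32 * 2 ^ k * #S : ℕ) : ℝ) := by
      push_cast; rw [← hP_R, hLdef]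
    exact_mod_cast e
  have hI_N : n₁ * (3 * 2 ^ k + t) + n₂ * (2 ^ k + t) + n₃ * t + #S = #S ^ 2 := by
    have e : ((n₁ * (3 * 2 ^ k + t) + n₂ * (2 ^ k + t) + n₃ * t + #S : ℕ) : ℝ) = ((#S ^ 2 : ℕ) : ℝ) := by
      push_cast; rw [← hI_R, hLdef]
    exact_mod_cast e
  have h4_N : #S ^ 4 + A * t ^ 4 + B * (2 ^ k + t) ^ 4 + C * (3 * 2 ^ k + t) ^ 4 =
      32 * 2 ^ k * (#S ^ 2 + n₁ * (3 * 2 ^ k + t) ^ 2 + n₂ * (2 ^ k + t) ^ 2 + n₃ * t ^ 2) := by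
    have e : ((#S ^ 4 + A * t ^ 4 + B * (2 ^ k + t) ^ 4 + C * (3 * 2 ^ k + t) ^ 4 : ℕ) : ℝ) =
        ((32 * 2 ^ k * (#S ^ 2 + n₁ * (3 * 2 ^ k + t) ^ 2 + n₂ * (2 ^ k + t) ^ 2 + n₃ * t ^ 2) : ℕ) : ℝ) := by
      push_cast; rw [hLdef] at h4_R; linear_combination h4_R
    exact_mod_cast e
  /- (8) `L ∣ t²` from `Σ I = w²` -/
  have hdvd : 2 ^ k ∣ t * t := by
    have e : ((t * t + 49 * 2 ^ k * 2 ^ k : ℕ) : ℤ) = ((2 ^ k * (3 * n₁ + n₂ + 18 * t + 7) : ℕ) : ℤ) := by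
      have hI' : ((n₁ * (3 * 2 ^ k + t) + n₂ * (2 ^ k + t) + n₃ * t + #S : ℕ) : ℤ) = ((#S ^ 2 : ℕ) : ℤ) := by rw [hI_N]
      have hn' : ((n₁ + n₂ + n₃ + 1 : ℕ) : ℤ) = ((32 * 2 ^ k : ℕ) : ℤ) := by rw [hn]
      push_cast at hI' hn' ⊢
      rw [hwt] at hI'
      push_cast at hI'
      linear_combination (-1 : ℤ) * hI' + (t : ℤ) * hn'
    have e' : t * t + 49 * 2 ^ k * 2 ^ k = 2 ^ k * (3 * n₁ + n₂ + 18 * t + 7) := by exact_mod_cast e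
    have hsum : 2 ^ k ∣ t * t + 49 * 2 ^ k * 2 ^ k := ⟨_, e'⟩
    exact (Nat.dvd_add_left (Dvd.intro_left (49 * 2 ^ k) (by ring))).1 hsum
  /- (9) the closure constraint `C + 1 = 2^j` (`ktg2_closure`) and assembly -/
  obtain ⟨j, hj⟩ := ktg2_closure k c hc t hwt ht0 h2t F (fun z => rfl) hFval
  exact ⟨#S, t, A, B, C, n₁, n₂, n₃, j, rfl, hwt, hdvd, hABC, hP_N, hn, hI_N, h4_N, hj⟩

end Summit.QuantumAdvantage.QuantumAdvantage.Theorems.CubicForrelation.NearExactIsExact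

end
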